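import Literature.AlgebraicGeometry.Motives.HodgeLieDerivedSemisimple
import HarnessLib

/-!
# `Lie Hg` of an effective polarizable weight-one Hodge structure has CENTRAL RADICAL over `ℚ` (it is reductive in Mathlib's sense)

Family `hodge`, layer `Literature/AlgebraicGeometry/Motives` (abstract polarizable `ℚ`-Hodge structures; no geometry). Cell
`pub-hodgecm2` (COR-CM), seat `b27` (count-neutral own lane MT-REDUCTIVE); UNCONDITIONAL, theorems only (no definition, no named
fact, D-0026); no step towards a summit statement. Sequel of `HodgeLieDerivedSemisimple` (`𝔡 = [𝔥, 𝔥]` has trivial radical) and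
`HodgeThetaSubalgebraReductive` (`𝔥 = 𝔷 ⊕ 𝔡`, `𝔷 = 𝔥 ∩ End_Hdg(V)` central).

PRINTED RESULT. P. Deligne, *Hodge cycles on abelian varieties*, LNM 900 (1982), I Prop. 3.6: «`MT(V, h)` est réductif»;
B. Moonen, Yu. Zarhin, Math. Ann. 315 (1999) §1: «`Hg(X)` is a connected reductive algebraic group». In Mathlib a Lie algebra is
called reductive when its radical is its centre (`LieAlgebra.HasCentralRadical`, docstring: «Such Lie algebras are called
*reductive*, if the coefficients are a field of characteristic zero»).

THIS FILE: **`hasCentralRadical_of_eq_hodgeLie`** — for an effective polarized `ℚ`-Hodge structure `H` of weight `1` on a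
finite-dimensional `V` and every Lie subalgebra `𝔏 ≤ 𝔤𝔩(V)` (commutator bracket `LieRing.ofAssociativeRing`, supplied by a
`letI`) with carrier `𝔥 = hodgeLie H`: `rad 𝔏 = Z(𝔏)`. PROOF: for `r ∈ rad 𝔏` and `x ∈ 𝔏`, `[x, r] ∈ rad 𝔏 ∩ 𝔡`; the elements
of `rad 𝔏` lying in `𝔡` form a solvable Lie ideal of (a Lie subalgebra with carrier) `𝔡` — solvable because it embeds into `rad 𝔏`
(`Function.Injective.lieAlgebra_isSolvable`) — hence vanish (`hasTrivialRadical_of_eq_hodgeLie_derived`,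
`HasTrivialRadical.eq_bot_of_isSolvable`); so `[x, r] = 0` and `r` is central (`LieAlgebra.hasCentralRadical_of_radical_le`).
Also `radical_le_inf_endAlg_of_eq_hodgeLie`: the elements of `rad 𝔏` lie in `𝔥 ∩ End_Hdg(V)`.
-/

noncomputable section

open scoped TensorProduct

namespace Literature.AlgebraicGeometry.Motives

namespace HodgeStructure

universe u

variable {V : Type u} [AddCommGroup V] [Module ℚ V] [Module.Finite ℚ V] [HodgeTensorFacts.{u, u}] {n : ℤ}

/-- **`Lie Hg(H)` is reductive over `ℚ`: its radical is its centre** (`LieAlgebra.HasCentralRadical ℚ 𝔏` for every Lie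
subalgebra `𝔏 ≤ 𝔤𝔩(V)` with carrier `hodgeLie H`; `H` effective, polarized, weight one). Deligne I 3.6 / Moonen–Zarhin §1 in
Mathlib's spelling of «reductive». [cite: Deligne1982HodgeCycles, I §3 Prop. 3.6] [cite: MoonenZarhin1999LowDim, §1] -/
theorem hasCentralRadical_of_eq_hodgeLie (H : HodgeStructure V n) (hn : n = 1) (heff : H.IsEffective) (ψ : H.Polarization) :
    letI : LieRing (Module.End ℚ V) := LieRing.ofAssociativeRing
    ∀ (𝔏 : LieSubalgebra ℚ (Module.End ℚ V)), 𝔏.toSubmodule = H.hodgeLie → LieAlgebra.HasCentralRadical ℚ 𝔏 := by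
  letI : LieRing (Module.End ℚ V) := LieRing.ofAssociativeRing
  intro 𝔏 h𝔏
  classical
  have hmem : ∀ X : Module.End ℚ V, X ∈ 𝔏 ↔ X ∈ H.hodgeLie := fun X => by
    rw [← LieSubalgebra.mem_toSubmodule, h𝔏]
  -- the derived algebra as a Lie subalgebra `𝔏d`, with trivial radical
  obtain ⟨𝔏d, h𝔏d⟩ := exists_lieSubalgebra_eq_hodgeLie_derived H
  haveI hrad : LieAlgebra.HasTrivialRadical ℚ 𝔏d := hasTrivialRadical_of_eq_hodgeLie_derived H hn heff ψ 𝔏d h𝔏d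
  have hmemd : ∀ X : Module.End ℚ V, X ∈ 𝔏d ↔
      X ∈ Submodule.span ℚ {B | ∃ X ∈ H.hodgeLie, ∃ Y ∈ H.hodgeLie, X * Y - Y * X = B} := fun X => by
    rw [← LieSubalgebra.mem_toSubmodule, h𝔏d]
  set R : LieIdeal ℚ 𝔏 := LieAlgebra.radical ℚ 𝔏 with hR
  -- the elements of `R` lying in `𝔡`, as a Lie ideal of `𝔏d`
  let R' : LieIdeal ℚ 𝔏d :=
    { carrier := {d | ∃ r : 𝔏, r ∈ R ∧ (r : Module.End ℚ V) = d}
      add_mem' := by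
        rintro d d' ⟨r, hr, hrd⟩ ⟨r', hr', hrd'⟩
        refine ⟨r + r', R.add_mem hr hr', ?_⟩
        change (r : Module.End ℚ V) + r' = (d : Module.End ℚ V) + d'
        rw [hrd, hrd']
      zero_mem' := ⟨0, R.zero_mem, rfl⟩
      smul_mem' := by
        rintro c d ⟨r, hr, hrd⟩
        refine ⟨c • r, R.smul_mem c hr, ?_⟩
        change c • (r : Module.End ℚ V) = c • (d : Module.End ℚ V)
        rw [hrd]
      lie_mem := by
        rintro x d ⟨r, hr, hrd⟩
        have hx𝔏 : ((x : 𝔏d) : Module.End ℚ V) ∈ 𝔏 :=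
          (hmem _).2 (Literature.Algebra.Lie.TraceSeparating.derived_le H.hodgeLie
            (fun X hX Y hY => H.commutator_mem_hodgeLie hX hY) ((hmemd _).1 x.2))
        refine ⟨⁅(⟨(x : Module.End ℚ V), hx𝔏⟩ : 𝔏), r⁆, R.lie_mem hr, ?_⟩
        rw [LieSubalgebra.coe_bracket, LieRing.of_associative_ring_bracket, hrd, LieSubalgebra.coe_bracket,
          LieRing.of_associative_ring_bracket] }
  have hR'mem : ∀ d : 𝔏d, d ∈ R' ↔ ∃ r : 𝔏, r ∈ R ∧ (r : Module.End ℚ V) = d := fun d => Iff.rfl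
  -- `R'` embeds into `R`, hence is solvable
  choose ρ hρR hρval using fun d : R' => (hR'mem _).1 d.2
  have hcoe : ∀ d d' : R', ((⁅d, d'⁆ : R') : 𝔏d) = ⁅(d : 𝔏d), (d' : 𝔏d)⁆ := fun d d' => rfl
  have hcoeR : ∀ a b : R, ((⁅a, b⁆ : R) : 𝔏) = ⁅(a : 𝔏), (b : 𝔏)⁆ := fun a b => rfl
  let φ : R' →ₗ⁅ℚ⁆ R :=
    { toFun := fun d => ⟨ρ d, hρR d⟩
      map_add' := fun d d' => by
        apply Subtype.ext; apply Subtype.ext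
        change (ρ (d + d') : Module.End ℚ V) = (ρ d : Module.End ℚ V) + ρ d'
        rw [hρval, hρval, hρval]
        rfl
      map_smul' := fun c d => by
        apply Subtype.ext; apply Subtype.ext
        change (ρ (c • d) : Module.End ℚ V) = c • (ρ d : Module.End ℚ V)
        rw [hρval, hρval]
        rfl
      map_lie' := fun {d d'} => by
        apply Subtype.ext; apply Subtype.ext
        change (ρ ⁅d, d'⁆ : Module.End ℚ V) = (((⁅(⟨ρ d, hρR d⟩ : R), ⟨ρ d', hρR d'⟩⁆ : R) : 𝔏) : Module.End ℚ V)
        rw [hρval, hcoe, hcoeR, LieSubalgebra.coe_bracket, LieRing.of_associative_ring_bracket,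
          LieSubalgebra.coe_bracket, LieRing.of_associative_ring_bracket]
        change _ = (ρ d : Module.End ℚ V) * ρ d' - ρ d' * ρ d
        rw [hρval, hρval] }
  have hφinj : Function.Injective φ := by
    intro d d' h
    have h' : (ρ d : Module.End ℚ V) = ρ d' := congrArg (fun r : R => ((r : 𝔏) : Module.End ℚ V)) h
    rw [hρval, hρval] at h'
    exact Subtype.ext (Subtype.ext h')
  haveI : LieAlgebra.IsSolvable R' := hφinj.lieAlgebra_isSolvable
  have hR'bot : R' = ⊥ := LieAlgebra.HasTrivialRadical.eq_bot_of_isSolvable R'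
  -- hence `[𝔏, R] = 0`: the radical is central
  refine LieAlgebra.hasCentralRadical_of_radical_le ℚ 𝔏 fun r hr => ?_
  rw [LieAlgebra.center, LieModule.mem_maxTrivSubmodule]
  intro x
  have hxr𝔡 : ((⁅x, r⁆ : 𝔏) : Module.End ℚ V) ∈
      Submodule.span ℚ {B | ∃ X ∈ H.hodgeLie, ∃ Y ∈ H.hodgeLie, X * Y - Y * X = B} := by
    rw [LieSubalgebra.coe_bracket, LieRing.of_associative_ring_bracket]
    exact Literature.Algebra.Lie.TraceSeparating.commutator_mem_derived H.hodgeLie ((hmem _).1 x.2) ((hmem _).1 r.2)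
  have hmemR' : (⟨((⁅x, r⁆ : 𝔏) : Module.End ℚ V), (hmemd _).2 hxr𝔡⟩ : 𝔏d) ∈ R' :=
    (hR'mem _).2 ⟨⁅x, r⁆, R.lie_mem hr, rfl⟩
  rw [hR'bot, LieSubmodule.mem_bot] at hmemR'
  have h0 : ((⁅x, r⁆ : 𝔏) : Module.End ℚ V) = 0 := congrArg Subtype.val hmemR'
  exact Subtype.ext h0

/-- **The radical of `Lie Hg(H)` lies in `Lie Hg ∩ End_Hdg(V)`** (its elements are `ψ`-skew central Hodge endomorphisms).
[cite: MoonenZarhin1999LowDim, §1] [cite: Deligne1982HodgeCycles, I §3 Prop. 3.6] -/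
theorem radical_le_inf_endAlg_of_eq_hodgeLie (H : HodgeStructure V n) (hn : n = 1) (heff : H.IsEffective)
    (ψ : H.Polarization) :
    letI : LieRing (Module.End ℚ V) := LieRing.ofAssociativeRing
    ∀ (𝔏 : LieSubalgebra ℚ (Module.End ℚ V)), 𝔏.toSubmodule = H.hodgeLie →
      ∀ r : 𝔏, r ∈ LieAlgebra.radical ℚ 𝔏 → (r : Module.End ℚ V) ∈ H.hodgeLie ⊓ Subalgebra.toSubmodule H.endAlg := by
  letI : LieRing (Module.End ℚ V) := LieRing.ofAssociativeRing
  intro 𝔏 h𝔏 r hr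
  haveI := hasCentralRadical_of_eq_hodgeLie H hn heff ψ 𝔏 h𝔏
  have hmem : ∀ X : Module.End ℚ V, X ∈ 𝔏 ↔ X ∈ H.hodgeLie := fun X => by
    rw [← LieSubalgebra.mem_toSubmodule, h𝔏]
  rw [LieAlgebra.radical_eq_center, LieAlgebra.center, LieModule.mem_maxTrivSubmodule] at hr
  rw [← hodgeLie_center_eq_inf_endAlg, Literature.Algebra.Lie.TraceSeparating.mem_center_iff]
  refine ⟨(hmem _).1 r.2, fun Y hY => ?_⟩
  have h := congrArg (fun s : 𝔏 => (s : Module.End ℚ V)) (hr ⟨Y, (hmem Y).2 hY⟩)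
  rw [LieSubalgebra.coe_bracket, LieRing.of_associative_ring_bracket, ZeroMemClass.coe_zero] at h
  exact (sub_eq_zero.1 h).symm

end HodgeStructure

end Literature.AlgebraicGeometry.Motives

end
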